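import Literature.MathematicalPhysics.QuantumFieldTheory.Balaban1983to89.Beta.WilsonWardJets2

/-!
# The order-`B²` Ward identity of the Wilson plaquette jets, second order in `W`, COLUMNWISE: four kernel-certified columns

HONEST FRAMING (cell `pub-balaban`, β sub-cell, lineage an3; verbatim): discharging `BetaPertH` makes Bałaban's UV stability
UNCONDITIONAL — a real constructive-QFT result; it is NOT the continuum limit and NOT the Clay problem.  This file discharges NOTHING
of `BetaPertH`.  ABSOLUTE RULE of the cell (verbatim): «No internally-minted statement may enter as a cited fact. Every hypothesis is
either kernel-proved in this package or a verbatim quotation of a PUBLISHED theorem with page reference. The manuscript(s) under audit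
are NOT citable for their own disputed steps — they are the thing under adjudication; programme-internal (2001/route/tribunal) claims
are never citable.»  Accordingly every declaration below is kernel-proved here from the imports; NOTHING is cited; no `def … : Prop`
occurs at all (no `def` at all).

## What is proved

Fourth file of the Ward series of the Wilson plaquette jets (`Beta.WilsonWardJets`: orders `B⁰`, `B¹`; `Beta.WilsonWardJets2`:
order `B²` first order in `W` + the integer closed forms used below; `Beta.WilsonWardEntries2`: order `B²` second order in `W`,
the sixteen matrix ENTRIES; read their headers for the setting, the chart `U_b = e^{W_b}·e^{B_b}` of
[Balaban1985BackgroundPropagators] (3.1) p. 390 = `Beta.WilsonVertex.plaq`, the corners `x₁ → x₂ → x₃ ← x₄ ← x₁` and bonds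
`b₁ : x₁ → x₂`, `b₂ : x₂ → x₃`, `b₃ : x₄ → x₃`, `b₄ : x₁ → x₄`, and the jets `F_{2,2} = τ∘P22`, `F_{2,1} = τ∘P21`, `F_{2,0} = τ∘quad∘wpart`,
`F_{1,2} = τ∘P12`, `F_{1,1} = τ∘P11`).  The ORDER-`B²` WARD IDENTITY, SECOND ORDER IN `W` — per plaquette —

  `4·Pol F_{2,2}(h, W₀λ) + 4·Pol F_{2,1}(h, W₁(B)λ) + 2·Pol F_{2,0}(h, 2W₂(B)λ) = 2·F_{1,2}(N₀(h)λ) + 2·F_{1,1}(N₁(h)λ)`     (E₂)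

(`Pol f(h,v) = f(h+v) − f(h) − f(v)`; gauge directions `W₀λ = λ(b₋) − λ(b₊)`, `W₁(B)λ = −[B_b, λ(b₊)]`, `2W₂(B)λ = −[B_b,[B_b,λ(b₊)]]`;
current arguments `N₀(h)λ = [h_b, λ(b₋)+λ(b₊)]`, `N₁(h)λ = [h_b,[B_b,λ(b₊)]]`) is proved here COLUMNWISE: the four theorems
`ward22_x{k}` (`k ∈ {1,2,3,4}`) take `h = (h₁, h₂, h₃, h₄)` ARBITRARY on all four bonds and the gauge parameter `λ` supported at the
single corner `x_k` (an arbitrary letter `l ∈ 𝔸` there), for EVERY ring `𝔸`, every `𝕜`-linear TRACIAL `τ`, all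
`B₁, …, B₄, h₁, …, h₄, l`.  A column is (E₂) for a gauge variation AT ONE LATTICE SITE tested against an arbitrary connection
variation `h` on the plaquette — the shape `(S₂ h) · w_{x,λ} + (N_{x,λ} h) · s₁ = 0` in which a matrix reading of hypothesis (I1) of
`Beta.LagrangianGaugeDegeneracy` (columns = site gauge parameters) meets the Hessian; unlike the sixteen ENTRIES of
`Beta.WilsonWardEntries2` (`h` on one bond), a column needs NO additivity of `Pol F_{2,•}` in `h` downstream.  The all-letters
form (λ at all four corners at once) is the sum of the four columns by additivity in `λ` and is NOT restated as a theorem (its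
one-shot certificate exceeds the normaliser's budget, see `Beta.WilsonWardJets2`'s header).  In each statement the groups that
vanish IDENTICALLY are omitted: for `λ` at the base corner `x₁` no bond of the word ENDS at the corner, so `W₁λ = W₂λ = N₁ = 0` and
only the `F_{2,2}` group appears on the Hessian side and only the `F_{1,2}` current on the right.  Letters: `W₀λ` puts `l` on the bonds
STARTING at `x_k` and `−l` on those ENDING there; `W₁(B)λ = l·B_b − B_b·l` and `2W₂(B)λ = B_b·(l·B_b − B_b·l) − (l·B_b − B_b·l)·B_b` on
the bond ending at `x_k`; `N₀ = h_b·l − l·h_b` on the bonds touching `x_k`; `N₁ = (l·B_b − B_b·l)·h_b − h_b·(l·B_b − B_b·l)` on the bond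
ending at `x_k`.

METHOD, uniform over the four columns (as in `Beta.WilsonWardEntries2`): the integer closed forms
`WilsonWardJets2.four_smul_trace_P22` / `four_smul_trace_P21` / `two_smul_trace_P12` / `two_smul_trace_P11`,
`WilsonWardJets.two_smul_trace_quad`, `WilsonWardJets2.two_smul_twist₂_plaq`, `WilsonVertex2.two_smul_qtwistAux` with the
recursion of `ctwistAux`, then ONE ring identity `inside_L − inside_R = Σ_a [a, P_a]` over the nine letters against an explicit
certificate (`WilsonWardJets.csum`, grouped by the left letter; collected differences 124 … 303 monomials, certificates
111 … 237, 671 certificate monomials in all), checked by `noncomm_ring`, and `τ` kills the commutators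
(`WilsonWardJets.trace_eq_of_sub_eq_csum`).  The raw expansions the normaliser digests here (≈ 13 000 … 20 000 monomials per
column) are an order of magnitude above the entries'; `maxHeartbeats` is raised per theorem accordingly (uniformly).  Statements,
certificates and scripts were generated by the archived exact engine `records/ward2/columns_gen.py` + `make_columns_leaf.py`
(free algebra over `ℚ`, each column's difference cyclically zero); the kernel re-verifies every ring identity and trusts nothing.

## Why (dictionary to `Beta.LagrangianGaugeDegeneracy`, hypothesis (I1), order `B²`)

`Beta.WilsonWardJets` §Why gives the graded reading `Σ_{j+k=n} 2·Pol F_{2,j}(h, W_kλ) = Σ_{j+k=n} F_{1,j}(N_k(h)λ)` of (I1) for the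
Wilson jets; `n = 0, 1` are `WilsonWardJets.ward20` / `ward21` (all letters), and (E₂) is TWICE the `n = 2` reading (the
`½` of `W₂` cleared: `2·Pol F_{2,0}(h, 2W₂λ) = 4·Pol F_{2,0}(h, W₂λ)`; `F_{1,0}(N₂λ) = 0` dropped: `WilsonWardJets.trace_wsum_plaq_comm`),
delivered entrywise in `Beta.WilsonWardEntries2` and columnwise here.
PROVENANCE (not used in proofs): invariance of `τ(U(∂p))` under `U_b ↦ u(x_{b₋}) U_b u(x_{b₊})⁻¹`, `u = e^{λ}`, second variation,
`B`-degree two.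

## What this file does NOT do

It does not restate (E₂) with `λ` at all four corners at once; nothing at order `B³` or higher; nothing about the minimiser
manifold, the hypotheses (K2), (L) of `Beta.LagrangianGaugeDegeneracy`, (c1)–(c3) of `Beta.GaugeFixing`, the matrix bookkeeping of
(I1) itself, or any estimate; it moves no wall statement; it is not summit progress, not the continuum limit, not Clay.
[folklore] throughout: multilinear algebra in an arbitrary normed algebra.
-/

namespace Literature.MathematicalPhysics.QuantumFieldTheory.Balaban1983to89.Beta.WilsonWardColumns2

open Literature.MathematicalPhysics.QuantumFieldTheory.Balaban1983to89.Beta.TransportVertices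
open Literature.MathematicalPhysics.QuantumFieldTheory.Balaban1983to89.Beta.WilsonVertex
open Literature.MathematicalPhysics.QuantumFieldTheory.Balaban1983to89.Beta.WilsonVertex2
open Literature.MathematicalPhysics.QuantumFieldTheory.Balaban1983to89.Beta.SpinTable (br)
open Literature.MathematicalPhysics.QuantumFieldTheory.Balaban1983to89.Beta.WilsonWardJets
  (csum csum_nil csum_cons trace_eq_of_sub_eq_csum two_smul_trace_quad)
open Literature.MathematicalPhysics.QuantumFieldTheory.Balaban1983to89.Beta.WilsonWardJets2
  (two_smul_twist₂_plaq four_smul_trace_P22 four_smul_trace_P21 two_smul_trace_P12 two_smul_trace_P11)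

/-! ## The four columns `ward22_x{k}` (`h` arbitrary on all bonds, `λ = l` at `x_k`; only the groups that do not vanish identically are listed) -/
section Columns

variable (𝕜 : Type*) [RCLike 𝕜] {𝔸 : Type*} [NormedRing 𝔸] [NormedAlgebra 𝕜 𝔸]
variable {V : Type*} [AddCommGroup V] [Module 𝕜 V]
variable (τ : 𝔸 →ₗ[𝕜] V) (B₁ B₂ B₃ B₄ h₁ h₂ h₃ h₄ l : 𝔸)

set_option maxHeartbeats 16000000 in
/-- **Column `x_1`** of the order-`B²` Ward identity (E₂): `h = (h₁, h₂, h₃, h₄)` arbitrary on the four bonds, `λ = l` at the corner `x_1` only (`b₁`, `b₄` start at `x₁` (none ends there)).  Hessian side `F_{2,2}` only (`W₁λ = W₂λ = 0`); current side `2·F_{1,2}(N₀)`.  Collected difference 303 monomials, certificate 237. [folklore] -/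
theorem ward22_x1 (hτ : ∀ a b : 𝔸, τ (a * b) = τ (b * a)) :
    (4 : 𝕜) • τ (P22 𝕜 (plaq (h₁ + l) h₂ h₃ (h₄ + l) B₁ B₂ B₃ B₄))
      - (4 : 𝕜) • τ (P22 𝕜 (plaq h₁ h₂ h₃ h₄ B₁ B₂ B₃ B₄))
      - (4 : 𝕜) • τ (P22 𝕜 (plaq l 0 0 l B₁ B₂ B₃ B₄)) =
      (2 : 𝕜) • τ (P12 𝕜 (plaq (h₁ * l - l * h₁) 0 0 (h₄ * l - l * h₄) B₁ B₂ B₃ B₄)) := by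
  simp only [four_smul_trace_P22 𝕜 τ hτ, two_smul_trace_P12 𝕜 τ, two_smul_twist₂_plaq, two_smul_qtwistAux, wpart_plaq, bpart_plaq,
    twist_plaq, sum_four_signed, two_smul_quad, commSum_four]
  simp only [plaq, ctwistAux_consW, ctwistAux_consB, ctwistAux_nil, twistAux_consW, twistAux_consB, twistAux_nil, wpart_consW,
    wpart_consB, wpart_nil, List.sum_cons, List.sum_nil]
  simp only [← map_add, ← map_sub]
  refine trace_eq_of_sub_eq_csum 𝕜 τ hτ
    [(B₁,
      2 * (B₁ * h₂ * l) + 2 * (B₂ * l * h₃) + 2 * (B₃ * h₃ * l) + 4 * (B₃ * l * h₁) + 2 * (B₃ * l * h₂) + 4 * (B₄ * l * h₁) + 2 * (B₄ * l * h₂) + 2 * (h₂ * B₂ * l) + 2 * (h₂ * l * B₃) + 2 * (h₂ * l * B₄) + 2 * (h₃ * B₄ * l) + 2 * (h₃ * l * B₂) + 2 * (l * B₂ * h₂) + 2 * (l * B₄ * h₃) + 2 * (l * h₂ * B₁) + 2 * (l * h₃ * B₃) - 2 * (B₁ * h₃ * l) - B₁ * h₄ * l - 2 * (B₁ * l * h₁)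 - B₁ * l * h₄ - 2 * (B₂ * h₃ * l) - 4 * (B₂ * l * h₁) - 2 * (B₂ * l * h₂) - 2 * (B₃ * l * h₃) - 2 * (B₄ * l * h₃) - 2 * (h₂ * B₃ * l) - 2 * (h₂ * B₄ * l) - 2 * (h₂ * l * B₂) - 2 * (h₃ * l * B₃) - 2 * (h₃ * l * B₄) - h₄ * l * B₁ - 2 * (l * B₃ * h₂) - 2 * (l * B₄ * h₂) - 2 * (l * h₁ * B₁) - 2 * (l * h₃ * B₁) - 2 * (l * h₃ * B₂) - l * h₄ * B₁),
    (B₂,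
      2 * (B₃ * h₃ * l) + 4 * (B₃ * l * h₁) + 4 * (B₃ * l * h₂) + 4 * (B₄ * l * h₁) + 4 * (B₄ * l * h₂) + 2 * (h₃ * B₄ * l) + 2 * (l * B₄ * h₃) + 2 * (l * h₃ * B₃) - 2 * (B₂ * h₃ * l) - B₂ * h₄ * l - 2 * (B₂ * l * h₁) - 2 * (B₂ * l * h₂) - B₂ * l * h₄ - 2 * (B₃ * l * h₃) - 2 * (B₄ * l * h₃) - 2 * (h₃ * l * B₃) - 2 * (h₃ * l * B₄) - h₄ * l * B₂ - 4 * (l * h₁ * B₁) - 2 * (l * h₁ * B₂) - 2 * (l * h₂ * B₂) - 2 * (l * h₃ * B₂) - l * h₄ * B₂),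
    (B₃,
      2 * (B₄ * l * h₃) + 2 * (h₃ * l * B₄) + 4 * (l * h₁ * B₁) + 4 * (l * h₁ * B₂) + 4 * (l * h₂ * B₂) - 2 * (B₃ * h₃ * l) - B₃ * h₄ * l - 2 * (B₃ * l * h₁) - 2 * (B₃ * l * h₂) - B₃ * l * h₄ - 4 * (B₄ * l * h₁) - 4 * (B₄ * l * h₂) - 2 * (h₃ * B₄ * l) - h₄ * l * B₃ - 2 * (l * B₄ * h₃) - 2 * (l * h₁ * B₃) - 2 * (l * h₂ * B₃) - 2 * (l * h₃ * B₃) - l * h₄ * B₃),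
    (B₄,
      2 * (B₄ * l * h₃) + 4 * (l * h₁ * B₁) + 4 * (l * h₁ * B₂) + 4 * (l * h₂ * B₂) + 2 * (l * h₃ * B₄) - B₄ * h₄ * l - 2 * (B₄ * l * h₁) - 2 * (B₄ * l * h₂) - B₄ * l * h₄ - h₄ * l * B₄ - 4 * (l * h₁ * B₃) - 2 * (l * h₁ * B₄) - 4 * (l * h₂ * B₃) - 2 * (l * h₂ * B₄) - l * h₄ * B₄),
    (h₁,
      4 * (B₁ * B₃ * l) + 4 * (B₁ * B₄ * l) + 4 * (B₂ * B₃ * l) + 4 * (B₂ * B₄ * l) - 2 * (B₁ * B₁ * l) - 4 * (B₁ * B₂ * l) - 2 * (B₂ * B₂ * l) - 2 * (B₃ * B₃ * l) - 4 * (B₃ * B₄ * l) - 2 * (B₄ * B₄ * l)),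
    (h₂,
      2 * (B₁ * B₃ * l) + 2 * (B₁ * B₄ * l) + 2 * (B₁ * l * B₁) + 2 * (B₁ * l * B₂) + 4 * (B₂ * B₃ * l) + 4 * (B₂ * B₄ * l) + 2 * (B₂ * l * B₁) + 2 * (l * B₃ * B₁) + 2 * (l * B₄ * B₁) - 2 * (B₁ * B₂ * l) - 2 * (B₁ * l * B₃) - 2 * (B₁ * l * B₄) - 2 * (B₂ * B₂ * l) - 2 * (B₃ * B₃ * l) - 4 * (B₃ * B₄ * l) - 2 * (B₃ * l * B₁) - 2 * (B₄ * B₄ * l) - 2 * (B₄ * l * B₁) - 2 * (l * B₂ * B₁)),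
    (h₃,
      2 * (B₁ * B₂ * l) + 2 * (B₁ * l * B₃) + 2 * (B₁ * l * B₄) + 2 * (B₂ * l * B₃) + 2 * (B₂ * l * B₄) + 2 * (B₃ * B₄ * l) + 2 * (B₃ * l * B₁) + 2 * (B₃ * l * B₂) + 2 * (B₄ * B₄ * l) + 2 * (B₄ * l * B₁) + 2 * (B₄ * l * B₂) + 2 * (l * B₂ * B₁) + 2 * (l * B₄ * B₃) - 2 * (B₁ * B₃ * l) - 2 * (B₁ * B₄ * l) - 2 * (B₁ * l * B₁) - 2 * (B₁ * l * B₂) - 2 * (B₂ * B₃ * l) - 2 * (B₂ * B₄ * l) - 2 * (B₂ * l * B₁) - 2 * (B₂ * l * B₂) - 2 * (B₃ * l * B₃) - 2 * (B₃ * l * B₄) - 2 * (B₄ * l * B₃) - 2 * (l * B₃ * B₁) - 2 * (l * B₃ * B₂) - 2 * (l * B₄ * B₁) - 2 * (l * B₄ * B₂)),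
    (h₄,
      2 * (B₁ * B₂ * l) + 2 * (B₁ * l * B₃) + 2 * (B₁ * l * B₄) + 2 * (B₂ * l * B₃) + 2 * (B₂ * l * B₄) + 2 * (B₃ * B₄ * l) + 2 * (B₃ * l * B₁) + 2 * (B₃ * l * B₂) + 2 * (B₄ * l * B₁) + 2 * (B₄ * l * B₂) + 2 * (l * B₂ * B₁) + 2 * (l * B₄ * B₃) - 2 * (B₁ * B₃ * l) - 2 * (B₁ * B₄ * l) - 2 * (B₁ * l * B₁) - 2 * (B₁ * l * B₂) - 2 * (B₂ * B₃ * l) - 2 * (B₂ * B₄ * l) - 2 * (B₂ * l * B₁) - 2 * (B₂ * l * B₂) - 2 * (B₃ * l * B₃) - 2 * (B₃ * l * B₄) - 2 * (B₄ * l * B₃) - 2 * (B₄ * l * B₄) - 2 * (l * B₃ * B₁) - 2 * (l * B₃ * B₂) - 2 * (l * B₄ * B₁) - 2 * (l * B₄ * B₂)),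
    (l,
      2 * (B₁ * B₁ * h₂) + 2 * (B₁ * B₃ * h₃) + 2 * (B₁ * B₃ * h₄) + 2 * (B₁ * B₄ * h₄) + 2 * (B₁ * h₂ * B₁) + 4 * (B₁ * h₂ * B₂) + 2 * (B₁ * h₃ * B₃) + 4 * (B₁ * h₃ * B₄) + 2 * (B₁ * h₄ * B₃) + 2 * (B₁ * h₄ * B₄) + 2 * (B₂ * B₃ * h₃) + 2 * (B₂ * B₃ * h₄) + 2 * (B₂ * B₄ * h₄) + 2 * (B₂ * h₃ * B₃) + 4 * (B₂ * h₃ * B₄) + 2 * (B₂ * h₄ * B₃) + 2 * (B₂ * h₄ * B₄) + 2 * (B₃ * h₃ * B₁) + 2 * (B₃ * h₃ * B₂) + 2 * (B₃ * h₄ * B₁) + 2 * (B₃ * h₄ * B₂) + 2 * (B₄ * h₄ * B₁) + 2 * (B₄ * h₄ * B₂) + 2 * (h₃ * B₂ * B₁) + 2 * (h₄ * B₂ * B₁) + 2 * (h₄ * B₄ * B₃) - 2 * (B₁ * B₁ * h₃) - 2 * (B₁ * B₁ * h₄) - 2 * (B₁ * B₂ * h₃) - 2 * (B₁ * B₂ *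 h₄) - 4 * (B₁ * h₂ * B₃) - 4 * (B₁ * h₂ * B₄) - 2 * (B₁ * h₃ * B₁) - 2 * (B₁ * h₃ * B₂) - 2 * (B₁ * h₄ * B₁) - 2 * (B₁ * h₄ * B₂) - 2 * (B₂ * B₂ * h₃) - 2 * (B₂ * B₂ * h₄) - 2 * (B₂ * h₃ * B₁) - 2 * (B₂ * h₃ * B₂) - 2 * (B₂ * h₄ * B₁) - 2 * (B₂ * h₄ * B₂) - 2 * (B₃ * B₃ * h₃) - 2 * (B₃ * B₃ * h₄) - 2 * (B₃ * B₄ * h₄) - 2 * (B₃ * h₃ * B₃) - 4 * (B₃ * h₃ * B₄) - 2 * (B₃ * h₄ * B₃) - 2 * (B₃ * h₄ * B₄) - 2 * (B₄ * B₄ * h₄) - 2 * (B₄ * h₄ * B₃) - 2 * (B₄ * h₄ * B₄) - 2 * (h₃ * B₃ * B₁) - 2 * (h₃ * B₃ * B₂) - 2 * (h₄ * B₃ * B₁) - 2 * (h₄ * B₃ * B₂) - 2 * (h₄ * B₄ * B₁) - 2 * (h₄ * B₄ * B₂))] ?_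
  simp only [csum_cons, csum_nil, br]
  noncomm_ring

set_option maxHeartbeats 16000000 in
/-- **Column `x_2`** of the order-`B²` Ward identity (E₂): `h = (h₁, h₂, h₃, h₄)` arbitrary on the four bonds, `λ = l` at the corner `x_2` only (`b₂` starts and `b₁` ends at `x₂`).  Hessian side `F_{2,2}`, `F_{2,1}`, `F_{2,0}`; current side `2·F_{1,2}(N₀)` + `2·F_{1,1}(N₁)`.  Collected difference 124 monomials, certificate 111. [folklore] -/
theorem ward22_x2 (hτ : ∀ a b : 𝔸, τ (a * b) = τ (b * a)) :
    (4 : 𝕜) • τ (P22 𝕜 (plaq (h₁ - l) (h₂ + l) h₃ h₄ B₁ B₂ B₃ B₄))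
      - (4 : 𝕜) • τ (P22 𝕜 (plaq h₁ h₂ h₃ h₄ B₁ B₂ B₃ B₄))
      - (4 : 𝕜) • τ (P22 𝕜 (plaq (-l) l 0 0 B₁ B₂ B₃ B₄))
      + ((4 : 𝕜) • τ (P21 𝕜 (plaq (h₁ + (l * B₁ - B₁ * l)) h₂ h₃ h₄ B₁ B₂ B₃ B₄))
          - (4 : 𝕜) • τ (P21 𝕜 (plaq h₁ h₂ h₃ h₄ B₁ B₂ B₃ B₄))
          - (4 : 𝕜) • τ (P21 𝕜 (plaq (l * B₁ - B₁ * l) 0 0 0 B₁ B₂ B₃ B₄)))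
      + ((2 : 𝕜) • τ (quad 𝕜 (wpart (plaq (h₁ + (B₁ * (l * B₁ - B₁ * l) - (l * B₁ - B₁ * l) * B₁)) h₂ h₃ h₄ B₁ B₂ B₃ B₄)))
          - (2 : 𝕜) • τ (quad 𝕜 (wpart (plaq h₁ h₂ h₃ h₄ B₁ B₂ B₃ B₄)))
          - (2 : 𝕜) • τ (quad 𝕜 (wpart (plaq (B₁ * (l * B₁ - B₁ * l) - (l * B₁ - B₁ * l) * B₁) 0 0 0 B₁ B₂ B₃ B₄)))) =
      (2 : 𝕜) • τ (P12 𝕜 (plaq (h₁ * l - l * h₁) (h₂ * l - l * h₂) 0 0 B₁ B₂ B₃ B₄)) + (2 : 𝕜) • τ (P11 (plaq ((l * B₁ - B₁ * l) * h₁ - h₁ * (l * B₁ - B₁ * l)) 0 0 0 B₁ B₂ B₃ B₄)) := by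
  simp only [four_smul_trace_P22 𝕜 τ hτ, four_smul_trace_P21 𝕜 τ hτ, two_smul_trace_quad 𝕜 τ, two_smul_trace_P12 𝕜 τ,
    two_smul_trace_P11 𝕜 τ, two_smul_twist₂_plaq, two_smul_qtwistAux, wpart_plaq, bpart_plaq, twist_plaq, sum_four_signed,
    two_smul_quad, commSum_four]
  simp only [plaq, ctwistAux_consW, ctwistAux_consB, ctwistAux_nil, twistAux_consW, twistAux_consB, twistAux_nil, wpart_consW,
    wpart_consB, wpart_nil, List.sum_cons, List.sum_nil]
  simp only [← map_add, ← map_sub]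
  refine trace_eq_of_sub_eq_csum 𝕜 τ hτ
    [(B₁,
      4 * (B₁ * l * h₃) + 4 * (B₁ * l * h₄) + 2 * (B₃ * h₃ * l) + 2 * (B₃ * h₄ * l) + 2 * (B₄ * h₄ * l) + 2 * (h₂ * B₃ * l) + 2 * (h₂ * B₄ * l) + 4 * (h₃ * B₂ * l) + 4 * (h₃ * l * B₁) + 4 * (h₄ * B₂ * l) + 4 * (h₄ * l * B₁) + 4 * (l * B₂ * h₃) + 4 * (l * B₂ * h₄) + 2 * (l * B₃ * h₂) + 2 * (l * B₄ * h₂) + 2 * (l * h₃ * B₃) + 2 * (l * h₄ * B₃) + 2 * (l * h₄ * B₄) - B₁ * h₁ * l - B₁ * h₂ * l - 3 * (B₁ * l * h₂) - 2 * (B₂ * h₃ * l) - 2 * (B₂ * h₄ * l) - h₁ * l * B₁ - 2 * (h₂ * B₂ * l) - 3 * (h₂ * l * B₁) - 4 * (h₃ * B₃ * l) - 2 * (h₃ * B₄ * l) - 4 * (h₄ * B₃ * l) - 4 * (h₄ * B₄ * l) - 2 * (l * B₂ * h₂) - 4 * (l * B₃ * h₃) - 4 * (l * B₃ * h₄) -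 2 * (l * B₄ * h₃) - 4 * (l * B₄ * h₄) - l * h₂ * B₁ - 2 * (l * h₃ * B₂) - 2 * (l * h₄ * B₂)),
    (B₂,
      2 * (B₁ * l * h₃) + 2 * (B₁ * l * h₄) + 2 * (h₃ * l * B₁) + 2 * (h₄ * l * B₁) - 2 * (B₁ * l * h₂) - 2 * (h₂ * l * B₁)),
    (B₃,
      2 * (B₁ * l * h₂) + 2 * (h₂ * l * B₁) - 2 * (B₁ * l * h₃) - 2 * (B₁ * l * h₄) - 2 * (h₃ * l * B₁) - 2 * (h₄ * l * B₁)),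
    (B₄,
      2 * (B₁ * l * h₂) + 2 * (h₂ * l * B₁) - 2 * (B₁ * l * h₃) - 2 * (B₁ * l * h₄) - 2 * (h₃ * l * B₁) - 2 * (h₄ * l * B₁)),
    (h₁,
      B₁ * B₁ * l - 2 * (B₁ * l * B₁)),
    (h₂,
      2 * (B₁ * l * B₃) + 2 * (B₁ * l * B₄) + 2 * (B₃ * l * B₁) + 2 * (B₄ * l * B₁) - 4 * (B₁ * l * B₁) - 2 * (B₁ * l * B₂) - 2 * (B₂ * l * B₁)),
    (h₃,
      4 * (B₁ * l * B₁) + 2 * (B₁ * l * B₂) + 2 * (B₂ * l * B₁) - 2 * (B₁ * l * B₃) - 2 * (B₁ * l * B₄) - 2 * (B₃ * l * B₁) - 2 * (B₄ * l * B₁)),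
    (h₄,
      4 * (B₁ * l * B₁) + 2 * (B₁ * l * B₂) + 2 * (B₂ * l * B₁) - 2 * (B₁ * l * B₃) - 2 * (B₁ * l * B₄) - 2 * (B₃ * l * B₁) - 2 * (B₄ * l * B₁)),
    (l,
      2 * (B₁ * B₃ * h₃) + 2 * (B₁ * B₃ * h₄) + 2 * (B₁ * B₄ * h₄) + 2 * (B₁ * h₂ * B₃) + 2 * (B₁ * h₂ * B₄) + 4 * (B₁ * h₃ * B₁) + 4 * (B₁ * h₃ * B₂) + 4 * (B₁ * h₄ * B₁) + 4 * (B₁ * h₄ * B₂) + 4 * (B₂ * h₃ * B₁) + 4 * (B₂ * h₄ * B₁) + 2 * (B₃ * h₂ * B₁) + 2 * (B₄ * h₂ * B₁) + 2 * (h₃ * B₃ * B₁) + 2 * (h₄ * B₃ * B₁) + 2 * (h₄ * B₄ * B₁) - B₁ * B₁ * h₁ - 2 * (B₁ * B₂ * h₃) - 2 * (B₁ * B₂ * h₄) - 4 * (B₁ * h₂ * B₁) - 2 * (B₁ * h₂ * B₂) - 4 * (B₁ * h₃ * B₃) - 2 * (B₁ * h₃ * B₄) - 4 * (B₁ * h₄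 * B₃) - 4 * (B₁ * h₄ * B₄) - 2 * (B₂ * h₂ * B₁) - 4 * (B₃ * h₃ * B₁) - 4 * (B₃ * h₄ * B₁) - 2 * (B₄ * h₃ * B₁) - 4 * (B₄ * h₄ * B₁) - 2 * (h₃ * B₂ * B₁) - 2 * (h₄ * B₂ * B₁))] ?_
  simp only [csum_cons, csum_nil, br]
  noncomm_ring

set_option maxHeartbeats 16000000 in
/-- **Column `x_3`** of the order-`B²` Ward identity (E₂): `h = (h₁, h₂, h₃, h₄)` arbitrary on the four bonds, `λ = l` at the corner `x_3` only (`b₂` and `b₃` end at `x₃` (none starts there)).  Hessian side `F_{2,2}`, `F_{2,1}`, `F_{2,0}`; current side `2·F_{1,2}(N₀)` + `2·F_{1,1}(N₁)`.  Collected difference 274 monomials, certificate 190. [folklore] -/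
theorem ward22_x3 (hτ : ∀ a b : 𝔸, τ (a * b) = τ (b * a)) :
    (4 : 𝕜) • τ (P22 𝕜 (plaq h₁ (h₂ - l) (h₃ - l) h₄ B₁ B₂ B₃ B₄))
      - (4 : 𝕜) • τ (P22 𝕜 (plaq h₁ h₂ h₃ h₄ B₁ B₂ B₃ B₄))
      - (4 : 𝕜) • τ (P22 𝕜 (plaq 0 (-l) (-l) 0 B₁ B₂ B₃ B₄))
      + ((4 : 𝕜) • τ (P21 𝕜 (plaq h₁ (h₂ + (l * B₂ - B₂ * l)) (h₃ + (l * B₃ - B₃ * l)) h₄ B₁ B₂ B₃ B₄))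
          - (4 : 𝕜) • τ (P21 𝕜 (plaq h₁ h₂ h₃ h₄ B₁ B₂ B₃ B₄))
          - (4 : 𝕜) • τ (P21 𝕜 (plaq 0 (l * B₂ - B₂ * l) (l * B₃ - B₃ * l) 0 B₁ B₂ B₃ B₄)))
      + ((2 : 𝕜) • τ (quad 𝕜 (wpart (plaq h₁ (h₂ + (B₂ * (l * B₂ - B₂ * l) - (l * B₂ - B₂ * l) * B₂)) (h₃ + (B₃ * (l * B₃ - B₃ * l) - (l * B₃ - B₃ * l) * B₃)) h₄ B₁ B₂ B₃ B₄)))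
          - (2 : 𝕜) • τ (quad 𝕜 (wpart (plaq h₁ h₂ h₃ h₄ B₁ B₂ B₃ B₄)))
          - (2 : 𝕜) • τ (quad 𝕜 (wpart (plaq 0 (B₂ * (l * B₂ - B₂ * l) - (l * B₂ - B₂ * l) * B₂) (B₃ * (l * B₃ - B₃ * l) - (l * B₃ - B₃ * l) * B₃) 0 B₁ B₂ B₃ B₄)))) =
      (2 : 𝕜) • τ (P12 𝕜 (plaq 0 (h₂ * l - l * h₂) (h₃ * l - l * h₃) 0 B₁ B₂ B₃ B₄)) + (2 : 𝕜) • τ (P11 (plaq 0 ((l * B₂ - B₂ * l) * h₂ - h₂ * (l * B₂ - B₂ * l)) ((l * B₃ - B₃ * l) * h₃ - h₃ * (l * B₃ - B₃ * l)) 0 B₁ B₂ B₃ B₄)) := by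
  simp only [four_smul_trace_P22 𝕜 τ hτ, four_smul_trace_P21 𝕜 τ hτ, two_smul_trace_quad 𝕜 τ, two_smul_trace_P12 𝕜 τ,
    two_smul_trace_P11 𝕜 τ, two_smul_twist₂_plaq, two_smul_qtwistAux, wpart_plaq, bpart_plaq, twist_plaq, sum_four_signed,
    two_smul_quad, commSum_four]
  simp only [plaq, ctwistAux_consW, ctwistAux_consB, ctwistAux_nil, twistAux_consW, twistAux_consB, twistAux_nil, wpart_consW,
    wpart_consB, wpart_nil, List.sum_cons, List.sum_nil]
  simp only [← map_add, ← map_sub]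
  refine trace_eq_of_sub_eq_csum 𝕜 τ hτ
    [(B₁,
      B₁ * h₃ * l + B₁ * l * h₂ + 2 * (B₂ * h₃ * l) + 2 * (B₂ * l * h₁) + 2 * (B₂ * l * h₃) + 4 * (B₂ * l * h₄) + 2 * (h₁ * B₃ * l) + 2 * (h₁ * l * B₂) + h₂ * l * B₁ + 4 * (h₃ * B₃ * l) + 2 * (h₃ * l * B₂) + 4 * (h₄ * B₃ * l) + 4 * (h₄ * l * B₂) + 2 * (l * B₃ * h₁) + 4 * (l * B₃ * h₃) + 4 * (l * B₃ * h₄) + l * h₃ * B₁ + 2 * (l * h₃ * B₂) - B₁ * h₂ * l - B₁ * l * h₃ - 2 * (B₃ * h₃ * l) - 2 * (B₃ * l * h₁) - 2 * (B₃ * l * h₃) - 4 * (B₃ * l * h₄) - 2 * (h₁ * B₂ * l) - 2 * (h₁ * l * B₃) - 4 * (h₃ * B₂ * l) - h₃ * l * B₁ - 2 * (h₃ * l * B₃) - 4 * (h₄ * B₂ * l) - 4 * (h₄ * l * B₃) - 2 * (l * B₂ * h₁) - 4 * (l * B₂ * h₃) - 4 * (l * B₂ * h₄) - l * h₂ * B₁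 - 2 * (l * h₃ * B₃)),
    (B₂,
      B₂ * h₃ * l + 2 * (B₂ * l * h₁) + 3 * (B₂ * l * h₃) + 4 * (B₂ * l * h₄) + 2 * (B₃ * h₄ * l) + 2 * (B₄ * h₄ * l) + 2 * (h₁ * l * B₂) + 2 * (h₂ * B₃ * l) + 3 * (h₃ * l * B₂) + 4 * (h₄ * l * B₂) + 2 * (l * B₃ * h₂) + l * h₃ * B₂ + 2 * (l * h₄ * B₃) + 2 * (l * h₄ * B₄) - B₂ * h₂ * l - 2 * (B₃ * l * h₁) - 2 * (B₃ * l * h₂) - 2 * (B₃ * l * h₃) - 4 * (B₃ * l * h₄) - 2 * (h₁ * B₄ * l) - 2 * (h₁ * l * B₃) - h₂ * l * B₂ - 2 * (h₂ * l * B₃) - 2 * (h₃ * B₄ * l) - 2 * (h₃ * l * B₃) - 4 * (h₄ * B₄ * l) - 4 * (h₄ * l * B₃) - 2 * (l * B₄ * h₁) - 2 * (l * B₄ * h₃) - 4 * (l * B₄ * h₄)),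
    (B₃,
      2 * (B₃ * l * h₁) + 2 * (B₃ * l * h₂) + 3 * (B₃ * l * h₃) + 4 * (B₃ * l * h₄) + 2 * (h₁ * B₄ * l) + 2 * (h₁ * l * B₃) + 2 * (h₂ * B₄ * l) + 2 * (h₂ * l * B₃) + 4 * (h₄ * B₄ * l) + 2 * (l * B₄ * h₁) + 2 * (l * B₄ * h₂) + 4 * (l * B₄ * h₄) + l * h₃ * B₃ - 2 * (B₂ * l * h₁) - 2 * (B₂ * l * h₃) - 2 * (B₂ * l * h₄) - 2 * (B₃ * h₃ * l) - 4 * (B₃ * h₄ * l) - 2 * (B₄ * h₄ * l) - 2 * (h₁ * l * B₂) - 2 * (h₃ * l * B₂) - 2 * (h₄ * l * B₂) - 2 * (l * h₄ * B₄)),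
    (B₄,
      2 * (B₃ * l * h₁) + 2 * (B₃ * l * h₂) + 2 * (B₃ * l * h₄) + 2 * (h₁ * l * B₃) + 2 * (h₂ * l * B₃) + 2 * (h₄ * l * B₃) - 2 * (B₂ * l * h₁) - 2 * (B₂ * l * h₃) - 2 * (B₂ * l * h₄) - 2 * (h₁ * l * B₂) - 2 * (h₃ * l * B₂) - 2 * (h₄ * l * B₂)),
    (h₁,
      2 * (B₂ * l * B₂) + 2 * (B₃ * l * B₃) + 2 * (B₃ * l * B₄) + 2 * (B₄ * l * B₃) - 2 * (B₂ * l * B₃) - 2 * (B₂ * l * B₄) - 2 * (B₃ * l * B₂) - 2 * (B₄ * l * B₂)),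
    (h₂,
      2 * (B₁ * B₃ * l) + 2 * (B₁ * l * B₂) + B₂ * B₂ * l + 2 * (B₂ * l * B₁) + 2 * (B₃ * l * B₃) + 2 * (B₃ * l * B₄) + 2 * (B₄ * l * B₃) + 2 * (l * B₃ * B₁) - 2 * (B₁ * B₂ * l) - 2 * (B₁ * l * B₃) - 2 * (B₂ * l * B₂) - 2 * (B₃ * l * B₁) - 2 * (l * B₂ * B₁)),
    (h₃,
      2 * (B₁ * B₂ * l) + 2 * (B₁ * l * B₃) + 4 * (B₂ * l * B₂) + 3 * (B₃ * B₃ * l) + 2 * (B₃ * l * B₁) + 2 * (l * B₂ * B₁) - 2 * (B₁ * B₃ * l) - 2 * (B₁ * l * B₂) - 2 * (B₂ * B₃ * l) - 2 * (B₂ * l * B₁) - 2 * (B₂ * l * B₄) - 2 * (B₃ * l * B₃) - 2 * (B₄ * l * B₂) - 2 * (l * B₃ * B₁) - 2 * (l * B₃ * B₂)),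
    (h₄,
      2 * (B₁ * B₂ * l) + 2 * (B₁ * l * B₃) + 4 * (B₂ * l * B₂) + 4 * (B₃ * B₃ * l) + 2 * (B₃ * l * B₁) + 2 * (B₃ * l * B₄) + 2 * (B₄ * l * B₃) + 2 * (l * B₂ * B₁) - 2 * (B₁ * B₃ * l) - 2 * (B₁ * l * B₂) - 2 * (B₂ * B₃ * l) - 2 * (B₂ * l * B₁) - 2 * (B₂ * l * B₄) - 4 * (B₃ * l * B₃) - 2 * (B₄ * l * B₂) - 2 * (l * B₃ * B₁) - 2 * (l * B₃ * B₂)),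
    (l,
      2 * (B₂ * B₃ * h₃) + 2 * (B₂ * B₃ * h₄) + 2 * (B₂ * B₄ * h₄) + 2 * (B₂ * h₁ * B₂) + 4 * (B₂ * h₃ * B₂) + 4 * (B₂ * h₄ * B₂) + 2 * (B₃ * h₁ * B₃) + 2 * (B₃ * h₁ * B₄) + 2 * (B₃ * h₂ * B₃) + 2 * (B₃ * h₂ * B₄) + 4 * (B₃ * h₃ * B₃) + 4 * (B₃ * h₄ * B₃) + 4 * (B₃ * h₄ * B₄) + 2 * (B₄ * h₁ * B₃) + 2 * (B₄ * h₂ * B₃) + 4 * (B₄ * h₄ * B₃) + 2 * (h₃ * B₃ * B₂) + 2 * (h₄ * B₃ * B₂) + 2 * (h₄ * B₄ * B₂) - B₂ * B₂ * h₂ - 2 * (B₂ * h₁ * B₃) - 2 * (B₂ * h₁ * B₄) - 4 * (B₂ * h₃ * B₃) - 2 * (B₂ * h₃ * B₄) - 4 * (B₂ * h₄ * B₃) - 4 * (B₂ * h₄ * B₄) - 3 * (B₃ * B₃ * h₃) - 4 * (B₃ * B₃ * h₄) - 2 * (B₃ * B₄ * h₄) - 2 * (B₃ * h₁ * B₂)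 - 4 * (B₃ * h₃ * B₂) - 4 * (B₃ * h₄ * B₂) - 2 * (B₄ * h₁ * B₂) - 2 * (B₄ * h₃ * B₂) - 4 * (B₄ * h₄ * B₂) - 2 * (h₄ * B₄ * B₃))] ?_
  simp only [csum_cons, csum_nil, br]
  noncomm_ring

set_option maxHeartbeats 16000000 in
/-- **Column `x_4`** of the order-`B²` Ward identity (E₂): `h = (h₁, h₂, h₃, h₄)` arbitrary on the four bonds, `λ = l` at the corner `x_4` only (`b₃` starts and `b₄` ends at `x₄`).  Hessian side `F_{2,2}`, `F_{2,1}`, `F_{2,0}`; current side `2·F_{1,2}(N₀)` + `2·F_{1,1}(N₁)`.  Collected difference 232 monomials, certificate 133. [folklore] -/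
theorem ward22_x4 (hτ : ∀ a b : 𝔸, τ (a * b) = τ (b * a)) :
    (4 : 𝕜) • τ (P22 𝕜 (plaq h₁ h₂ (h₃ + l) (h₄ - l) B₁ B₂ B₃ B₄))
      - (4 : 𝕜) • τ (P22 𝕜 (plaq h₁ h₂ h₃ h₄ B₁ B₂ B₃ B₄))
      - (4 : 𝕜) • τ (P22 𝕜 (plaq 0 0 l (-l) B₁ B₂ B₃ B₄))
      + ((4 : 𝕜) • τ (P21 𝕜 (plaq h₁ h₂ h₃ (h₄ + (l * B₄ - B₄ * l)) B₁ B₂ B₃ B₄))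
          - (4 : 𝕜) • τ (P21 𝕜 (plaq h₁ h₂ h₃ h₄ B₁ B₂ B₃ B₄))
          - (4 : 𝕜) • τ (P21 𝕜 (plaq 0 0 0 (l * B₄ - B₄ * l) B₁ B₂ B₃ B₄)))
      + ((2 : 𝕜) • τ (quad 𝕜 (wpart (plaq h₁ h₂ h₃ (h₄ + (B₄ * (l * B₄ - B₄ * l) - (l * B₄ - B₄ * l) * B₄)) B₁ B₂ B₃ B₄)))
          - (2 : 𝕜) • τ (quad 𝕜 (wpart (plaq h₁ h₂ h₃ h₄ B₁ B₂ B₃ B₄)))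
          - (2 : 𝕜) • τ (quad 𝕜 (wpart (plaq 0 0 0 (B₄ * (l * B₄ - B₄ * l) - (l * B₄ - B₄ * l) * B₄) B₁ B₂ B₃ B₄)))) =
      (2 : 𝕜) • τ (P12 𝕜 (plaq 0 0 (h₃ * l - l * h₃) (h₄ * l - l * h₄) B₁ B₂ B₃ B₄)) + (2 : 𝕜) • τ (P11 (plaq 0 0 0 ((l * B₄ - B₄ * l) * h₄ - h₄ * (l * B₄ - B₄ * l)) B₁ B₂ B₃ B₄)) := by
  simp only [four_smul_trace_P22 𝕜 τ hτ, four_smul_trace_P21 𝕜 τ hτ, two_smul_trace_quad 𝕜 τ, two_smul_trace_P12 𝕜 τ,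
    two_smul_trace_P11 𝕜 τ, two_smul_twist₂_plaq, two_smul_qtwistAux, wpart_plaq, bpart_plaq, twist_plaq, sum_four_signed,
    two_smul_quad, commSum_four]
  simp only [plaq, ctwistAux_consW, ctwistAux_consB, ctwistAux_nil, twistAux_consW, twistAux_consB, twistAux_nil, wpart_consW,
    wpart_consB, wpart_nil, List.sum_cons, List.sum_nil]
  simp only [← map_add, ← map_sub]
  refine trace_eq_of_sub_eq_csum 𝕜 τ hτ
    [(B₁,
      B₁ * h₃ * l + B₁ * h₄ * l + 2 * (B₂ * h₃ * l) + 2 * (B₂ * h₄ * l) + 2 * (B₃ * l * h₃) + 2 * (B₃ * l * h₄) + 2 * (h₁ * B₄ * l) + 2 * (h₃ * l * B₃) + 4 * (h₄ * B₄ * l) + 2 * (h₄ * l * B₃) + 2 * (l * B₄ * h₁) + 4 * (l * B₄ * h₄) + l * h₃ * B₁ + 2 * (l * h₃ * B₂) + l * h₄ * B₁ + 2 * (l * h₄ * B₂) - B₁ * l * h₃ - B₁ * l * h₄ - 2 * (B₂ * l * h₃) - 2 * (B₂ * l * h₄) - 2 * (B₃ * h₃ * l) - 2 * (B₃ * h₄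 * l) - 2 * (B₄ * h₄ * l) - 2 * (B₄ * l * h₁) - 2 * (B₄ * l * h₄) - 2 * (h₁ * l * B₄) - h₃ * l * B₁ - 2 * (h₃ * l * B₂) - h₄ * l * B₁ - 2 * (h₄ * l * B₂) - 2 * (h₄ * l * B₄) - 2 * (l * h₃ * B₃) - 2 * (l * h₄ * B₃) - 2 * (l * h₄ * B₄)),
    (B₂,
      B₂ * h₃ * l + B₂ * h₄ * l + 2 * (B₃ * l * h₃) + 2 * (B₃ * l * h₄) + 2 * (h₁ * B₄ * l) + 2 * (h₂ * B₄ * l) + 2 * (h₃ * l * B₃) + 4 * (h₄ * B₄ * l) + 2 * (h₄ * l * B₃) + 2 * (l * B₄ * h₁) + 2 * (l * B₄ * h₂) + 4 * (l * B₄ * h₄) + l * h₃ * B₂ + l * h₄ * B₂ - B₂ * l * h₃ - B₂ * l * h₄ - 2 * (B₃ * h₃ * l) - 2 * (B₃ * h₄ * l) - 2 * (B₄ * h₄ * l) - 2 * (B₄ * l * h₁) - 2 * (B₄ * l * h₂) - 2 * (B₄ * l * h₄) - 2 * (h₁ * l * B₄) - 2 * (h₂ * l * B₄) - h₃ * l *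 B₂ - h₄ * l * B₂ - 2 * (h₄ * l * B₄) - 2 * (l * h₃ * B₃) - 2 * (l * h₄ * B₃) - 2 * (l * h₄ * B₄)),
    (B₃,
      B₃ * h₃ * l + B₃ * h₄ * l + 2 * (B₄ * h₄ * l) + 2 * (B₄ * l * h₁) + 2 * (B₄ * l * h₂) + 2 * (B₄ * l * h₄) + 2 * (h₁ * l * B₄) + 2 * (h₂ * l * B₄) + 2 * (h₄ * l * B₄) + l * h₃ * B₃ + l * h₄ * B₃ + 2 * (l * h₄ * B₄) - B₃ * l * h₃ - B₃ * l * h₄ - 2 * (h₁ * B₄ * l) - 2 * (h₂ * B₄ * l) - h₃ * l * B₃ - 4 * (h₄ * B₄ * l) - h₄ * l * B₃ - 2 * (l * B₄ * h₁) - 2 * (l * B₄ * h₂) - 4 * (l * B₄ * h₄)),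
    (B₄,
      2 * (B₄ * l * h₁) + 2 * (B₄ * l * h₂) + 3 * (B₄ * l * h₄) + 2 * (h₁ * l * B₄) + 2 * (h₂ * l * B₄) + l * h₄ * B₄ - 2 * (B₄ * h₄ * l) - 2 * (B₄ * l * h₃) - 2 * (h₃ * l * B₄)),
    (h₁,
      2 * (B₄ * l * B₄)),
    (h₂,
      2 * (B₁ * B₄ * l) + 2 * (B₄ * l * B₄) + 2 * (l * B₄ * B₁) - 2 * (B₁ * l * B₄) - 2 * (B₄ * l * B₁)),
    (h₃,
      2 * (B₁ * l * B₄) + 2 * (B₂ * l * B₄) + 2 * (B₃ * B₄ * l) + 2 * (B₄ * l * B₁) + 2 * (B₄ * l * B₂) + 2 * (l * B₄ * B₃) - 2 * (B₁ * B₄ * l) - 2 * (B₂ * B₄ * l) - 2 * (B₃ * l * B₄) - 2 * (B₄ * l * B₃) - 2 * (B₄ * l * B₄) - 2 * (l * B₄ * B₁) - 2 * (l * B₄ * B₂)),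
    (h₄,
      2 * (B₁ * l * B₄) + 2 * (B₂ * l * B₄) + 2 * (B₃ * B₄ * l) + 3 * (B₄ * B₄ * l) + 2 * (B₄ * l * B₁) + 2 * (B₄ * l * B₂) + 2 * (l * B₄ * B₃) - 2 * (B₁ * B₄ * l) - 2 * (B₂ * B₄ * l) - 2 * (B₃ * l * B₄) - 2 * (B₄ * l * B₃) - 2 * (B₄ * l * B₄) - 2 * (l * B₄ * B₁) - 2 * (l * B₄ * B₂)),
    (l,
      2 * (B₄ * h₁ * B₄) + 2 * (B₄ * h₂ * B₄) + 4 * (B₄ * h₄ * B₄) - 3 * (B₄ * B₄ * h₄) - 2 * (B₄ * h₃ * B₄))] ?_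
  simp only [csum_cons, csum_nil, br]
  noncomm_ring

end Columns

end Literature.MathematicalPhysics.QuantumFieldTheory.Balaban1983to89.Beta.WilsonWardColumns2
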